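import Summits.Parity.GeneralizedHardyLittlewood.Theorems.LiouvilleShiftedTablesPairsHLOdd
import Summits.Parity.GeneralizedHardyLittlewood.Theorems.LiouvilleShiftedTablesPairsHLBounds
import Literature.NumberTheory.Sieve.HardyLittlewood

/-!
# `PairsHL`: logical status — between the prime `k`-tuples and the twin prime conjectures

Route `LiouvilleShiftedTables` (Parity / GeneralizedHardyLittlewood), support item stmt-Parity-9387
(`Summit.Parity.GeneralizedHardyLittlewood.Theses.LiouvilleShiftedTables.PairsHL`):
for every `h ≥ 1`, `∑_{n ≤ N} Λ(n) Λ(n+h) = 𝔖({0,h}) N + o(N)`.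

This file pins down the logical status of the item (an open problem as filed):

* `pairsHL_shift_of_count` — for one shift `h`: `π_{{0,h}}(x) ∼ 𝔖 x / log² x` implies
  `∑_{n ≤ N} Λ(n)Λ(n+h) − 𝔖 N = o(N)` (take `M = ⌊N^{1−δ}⌋`, `δ → 0`);
* `pairsHL_of_hardyLittlewoodTuples` — the registered open conjecture
  `Literature.NumberTheory.Sieve.HardyLittlewoodTuples` (parity.S01, prime `k`-tuples in counting
  form; only the pairs `{0,h}` are used) implies `PairsHL`;
* `forall_exists_pair_of_pairsHL_shift`, `twinPrimeConjecture_of_pairsHL` — `PairsHL` (already its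
  `h = 2` instance) implies the twin prime conjecture
  `Literature.NumberTheory.Sieve.TwinPrimeConjecture` (parity.S03, open); more generally the
  `Λ`-asymptotic at any shift with `𝔖({0,h}) > 0` gives infinitely many prime pairs `p, p + h`;
* `count_of_pairsHL_shift` — conversely, the `Λ`-asymptotic at a shift with `𝔖({0,h}) > 0` gives
  the counting form `π_{{0,h}}(x) ∼ 𝔖({0,h}) x / log² x`;
* `pairsHL_iff_count_even` — hence `PairsHL` is EQUIVALENT to the Hardy–Littlewood prime-pair
  conjecture in counting form at every even shift (the tuples `{0, h}` of the `k = 2` slice of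
  `Literature.NumberTheory.Sieve.HardyLittlewoodTuples`).
-/

open Finset Filter Asymptotics ArithmeticFunction

noncomputable section

namespace Summit.Parity.GeneralizedHardyLittlewood.Theorems.PairsHL

open Literature.NumberTheory.Sieve
open Summit.Parity.GeneralizedHardyLittlewood.Theses.LiouvilleShiftedTables (PairsHL)

/-! ### From the counting form to the `Λ`-form -/

/-- Unpacking the counting hypothesis: for large `N`,
`(1−δ) 𝔖 N / log² N ≤ π_{{0,h}}(N) ≤ (1+δ) 𝔖 N / log² N`. [folklore] -/
theorem eventually_count_bounds {h : ℕ}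
    (hc : (fun x : ℕ ↦ (primeTupleCount ({0, (h : ℤ)} : Finset ℤ) x : ℝ)) ~[atTop]
      fun x : ℕ ↦ singularSeries ({0, (h : ℤ)} : Finset ℤ) * x / Real.log x ^ 2)
    {δ : ℝ} (hδ : 0 < δ) :
    ∀ᶠ N : ℕ in atTop,
      (#((Icc 1 N).filter fun n ↦ n.Prime ∧ (n + h).Prime) : ℝ)
          ≤ (1 + δ) * (singularSeries ({0, (h : ℤ)} : Finset ℤ) * N / Real.log N ^ 2) ∧
        (1 - δ) * (singularSeries ({0, (h : ℤ)} : Finset ℤ) * N / Real.log N ^ 2)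
          ≤ #((Icc 1 N).filter fun n ↦ n.Prime ∧ (n + h).Prime) := by
  have hS0 : 0 ≤ singularSeries ({0, (h : ℤ)} : Finset ℤ) := singularSeries_nonneg_holds _
  filter_upwards [hc.isLittleO.def hδ] with N hN
  have hg0 : 0 ≤ singularSeries ({0, (h : ℤ)} : Finset ℤ) * N / Real.log N ^ 2 := by
    positivity
  simp only [Pi.sub_apply, Real.norm_eq_abs, primeTupleCount_pair] at hN
  rw [abs_of_nonneg hg0] at hN
  obtain ⟨h1, h2⟩ := abs_le.mp hN
  constructor <;> linarith

/-- **One shift.** If `π_{{0,h}}(x) ∼ 𝔖({0,h}) x / log² x` (the Hardy–Littlewood prime-pair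
conjecture at the shift `h`, counting form), then `∑_{n ≤ N} Λ(n)Λ(n+h) = 𝔖({0,h}) N + o(N)`.
Proof: the prime pairs give `S₁(N) ≤ π_h(N) log N log(N+h) ≤ (1+δ)² 𝔖 N` and, dropping
`n ≤ N^{1−δ}`, `S₁(N) ≥ (π_h(N) − N^{1−δ})(1−δ)² log² N ≥ (1−δ)³ 𝔖 N − δ N`; proper prime powers
add `o(N)` (`abs_sub_le_of_bounds`). [folklore; cite: HardyLittlewood1923, Conjecture B] -/
theorem pairsHL_shift_of_count {h : ℕ}
    (hc : (fun x : ℕ ↦ (primeTupleCount ({0, (h : ℤ)} : Finset ℤ) x : ℝ)) ~[atTop]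
      fun x : ℕ ↦ singularSeries ({0, (h : ℤ)} : Finset ℤ) * x / Real.log x ^ 2) :
    (fun N : ℕ => ∑ n ∈ Finset.Icc 1 N, ArithmeticFunction.vonMangoldt n *
        ArithmeticFunction.vonMangoldt (n + h)
        - Literature.NumberTheory.Sieve.singularSeries ({0, (h : ℤ)} : Finset ℤ) * N)
      =o[Filter.atTop] fun N : ℕ => (N : ℝ) := by
  have hS0 : 0 ≤ singularSeries ({0, (h : ℤ)} : Finset ℤ) := singularSeries_nonneg_holds _
  refine isLittleO_iff.mpr fun ε hε ↦ ?_
  -- the auxiliary parameter `δ`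
  obtain ⟨δ, hδ0, hδ1, hδε⟩ : ∃ δ : ℝ, 0 < δ ∧ δ ≤ 1 / 2 ∧
      δ * (3 * singularSeries ({0, (h : ℤ)} : Finset ℤ) + 2) ≤ ε := by
    refine ⟨min (1 / 2) (ε / (3 * singularSeries ({0, (h : ℤ)} : Finset ℤ) + 2)),
      by positivity, min_le_left _ _, ?_⟩
    calc min (1 / 2) (ε / (3 * singularSeries ({0, (h : ℤ)} : Finset ℤ) + 2))
          * (3 * singularSeries ({0, (h : ℤ)} : Finset ℤ) + 2)
        ≤ ε / (3 * singularSeries ({0, (h : ℤ)} : Finset ℤ) + 2)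
          * (3 * singularSeries ({0, (h : ℤ)} : Finset ℤ) + 2) := by
          gcongr
          exact min_le_right _ _
      _ = ε := div_mul_cancel₀ _ (by positivity)
  filter_upwards [eventually_count_bounds hc hδ0, eventually_log_add_le h hδ0,
    eventually_rpow_mul_log_sq_le hδ0, eventually_properPower_bound_le h hδ0,
    eventually_ge_atTop 2] with N hPN hcN hdN heN hN2
  have hN0 : (0 : ℝ) < N := by exact_mod_cast (by omega : 0 < N)
  have hLN : 0 < Real.log (N : ℝ) := Real.log_pos (by exact_mod_cast (by omega : 1 < N))
  have hLh0 : 0 ≤ Real.log ((N + h : ℕ) : ℝ) := Real.log_natCast_nonneg _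
  -- the cut-off `M = ⌊N^{1-δ}⌋`
  set M : ℕ := ⌊(N : ℝ) ^ (1 - δ)⌋₊ with hM
  have hMle : (M : ℝ) ≤ (N : ℝ) ^ (1 - δ) := Nat.floor_le (by positivity)
  have hMlt : (N : ℝ) ^ (1 - δ) < ((M + 1 : ℕ) : ℝ) := by
    push_cast
    exact Nat.lt_floor_add_one _
  have hLM : (1 - δ) * Real.log N ≤ Real.log ((M + 1 : ℕ) : ℝ) := by
    calc (1 - δ) * Real.log N = Real.log ((N : ℝ) ^ (1 - δ)) := (Real.log_rpow hN0 _).symm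
      _ ≤ Real.log ((M + 1 : ℕ) : ℝ) := Real.log_le_log (by positivity) hMlt.le
  have hsplit : ∑ n ∈ Icc 1 N, vonMangoldt n * vonMangoldt (n + h)
      = ∑ n ∈ (Icc 1 N).filter (fun n ↦ n.Prime ∧ (n + h).Prime),
          vonMangoldt n * vonMangoldt (n + h)
        + ∑ n ∈ (Icc 1 N).filter (fun n ↦ ¬ (n.Prime ∧ (n + h).Prime)),
          vonMangoldt n * vonMangoldt (n + h) :=
    (sum_filter_add_sum_filter_not _ _ _).symm
  rw [Real.norm_eq_abs, Real.norm_of_nonneg hN0.le, hsplit]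
  exact abs_sub_le_of_bounds hS0 hN0 hLN hLh0 hδ0 hδ1 hδε hPN.1 hPN.2 hcN
    (sum_bothPrime_le h N) (sub_mul_log_sq_le_sum_bothPrime h N M)
    (sum_nonneg fun _ _ ↦ mul_nonneg vonMangoldt_nonneg vonMangoldt_nonneg)
    (sum_nonneg fun _ _ ↦ mul_nonneg vonMangoldt_nonneg vonMangoldt_nonneg)
    ((sum_not_bothPrime_le h N).trans heN) hMle (by positivity) hdN hLM

/-- **`HardyLittlewoodTuples → PairsHL`.** The registered open conjecture parity.S01
(Hardy–Littlewood prime `k`-tuples, counting form) implies the route item `PairsHL`: for even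
`h ≥ 2` the pair `{0, h}` is admissible of cardinality `2` and `pairsHL_shift_of_count` applies; odd
shifts are unconditional (`pairsHL_odd`). [cite: HardyLittlewood1923, Conjecture B] -/
theorem pairsHL_of_hardyLittlewoodTuples (hHL : HardyLittlewoodTuples) : PairsHL := by
  intro h hh
  rcases Nat.even_or_odd h with he | ho
  · have hc := hHL _ (isAdmissibleTuple_pair_of_even he hh)
    rw [card_pair_of_pos hh] at hc
    exact pairsHL_shift_of_count hc
  · exact pairsHL_odd ho

/-! ### Infinitely many prime pairs -/

/-- If `∑_{n ≤ N} Λ(n)Λ(n+h) = 𝔖 N + o(N)` with `𝔖 = 𝔖({0,h}) > 0`, there are infinitely many `p`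
with `p` and `p + h` prime: otherwise the prime-pair part of the sum is bounded while the proper
prime powers contribute `o(N)`. [folklore] -/
theorem forall_exists_pair_of_pairsHL_shift {h : ℕ}
    (hS : 0 < singularSeries ({0, (h : ℤ)} : Finset ℤ))
    (hP : (fun N : ℕ => ∑ n ∈ Finset.Icc 1 N, ArithmeticFunction.vonMangoldt n *
        ArithmeticFunction.vonMangoldt (n + h)
        - Literature.NumberTheory.Sieve.singularSeries ({0, (h : ℤ)} : Finset ℤ) * N)
      =o[Filter.atTop] fun N : ℕ => (N : ℝ)) :
    ∀ n : ℕ, ∃ p, n < p ∧ p.Prime ∧ (p + h).Prime := by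
  by_contra hcon
  simp only [not_forall, not_exists, not_and] at hcon
  obtain ⟨n₀, hn₀⟩ := hcon
  set C₀ := ∑ n ∈ Icc 1 n₀, vonMangoldt n * vonMangoldt (n + h) with hC₀
  have hS₁ : ∀ N, ∑ n ∈ (Icc 1 N).filter (fun n ↦ n.Prime ∧ (n + h).Prime),
      vonMangoldt n * vonMangoldt (n + h) ≤ C₀ := by
    intro N
    refine sum_le_sum_of_subset_of_nonneg (fun p hp ↦ ?_)
      fun _ _ _ ↦ mul_nonneg vonMangoldt_nonneg vonMangoldt_nonneg
    rw [mem_filter, mem_Icc] at hp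
    rw [mem_Icc]
    refine ⟨hp.1.1, ?_⟩
    by_contra hlt
    exact hn₀ p (by omega) hp.2.1 hp.2.2
  have hS4 : 0 < singularSeries ({0, (h : ℤ)} : Finset ℤ) / 4 := by positivity
  obtain ⟨N, hTN, heN, hbig⟩ := ((hP.def hS4).and ((eventually_properPower_bound_le h hS4).and
    (tendsto_natCast_atTop_atTop.eventually_gt_atTop
      (2 * C₀ / singularSeries ({0, (h : ℤ)} : Finset ℤ))))).exists
  have hsplit : ∑ n ∈ Icc 1 N, vonMangoldt n * vonMangoldt (n + h)
      = ∑ n ∈ (Icc 1 N).filter (fun n ↦ n.Prime ∧ (n + h).Prime),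
          vonMangoldt n * vonMangoldt (n + h)
        + ∑ n ∈ (Icc 1 N).filter (fun n ↦ ¬ (n.Prime ∧ (n + h).Prime)),
          vonMangoldt n * vonMangoldt (n + h) :=
    (sum_filter_add_sum_filter_not _ _ _).symm
  rw [Real.norm_eq_abs, Real.norm_of_nonneg (Nat.cast_nonneg N), hsplit] at hTN
  have h1 := (abs_le.mp hTN).1
  have h2 := hS₁ N
  have h3 := (sum_not_bothPrime_le h N).trans heN
  have h4 : 2 * C₀ < N * singularSeries ({0, (h : ℤ)} : Finset ℤ) := (div_lt_iff₀ hS).mp hbig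
  nlinarith

/-- **`PairsHL` implies the twin prime conjecture** (parity.S03): `𝔖({0,2}) = 2 C₂ > 0`, so the
`h = 2` instance of `PairsHL` gives infinitely many twin primes. In particular no proof of the item
is possible short of the twin prime conjecture. [folklore] -/
theorem twinPrimeConjecture_of_pairsHL (hP : PairsHL) : TwinPrimeConjecture :=
  forall_exists_pair_of_pairsHL_shift
    (singularSeries_pair_pos_of_even (h := 2) (by decide) (by norm_num)) (hP 2 (by norm_num))

/-- `PairsHL` gives prime pairs `p, p + h` beyond every bound, for every even `h ≥ 2`
(de Polignac / Kronecker prime pairs). [folklore] -/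
theorem forall_exists_pair_of_pairsHL (hP : PairsHL) {h : ℕ} (he : Even h) (hh : 1 ≤ h) :
    ∀ n : ℕ, ∃ p, n < p ∧ p.Prime ∧ (p + h).Prime :=
  forall_exists_pair_of_pairsHL_shift (singularSeries_pair_pos_of_even he hh) (hP h hh)

/-! ### From the `Λ`-form back to the counting form -/

/-- **Converse at one shift.** If `𝔖({0,h}) > 0` and `∑_{n ≤ N} Λ(n)Λ(n+h) = 𝔖({0,h}) N + o(N)`,
then `π_{{0,h}}(x) ∼ 𝔖({0,h}) x / log² x`: upper bound from
`(π_h(N) − N^{1−δ})(1−δ)² log² N ≤ S₁(N)`, lower bound from `S₁(N) ≤ π_h(N) log N log(N+h)`, the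
proper prime powers being `o(N)` (`abs_count_sub_le_of_bounds`). [folklore] -/
theorem count_of_pairsHL_shift {h : ℕ} (hS : 0 < singularSeries ({0, (h : ℤ)} : Finset ℤ))
    (hP : (fun N : ℕ => ∑ n ∈ Finset.Icc 1 N, ArithmeticFunction.vonMangoldt n *
        ArithmeticFunction.vonMangoldt (n + h)
        - Literature.NumberTheory.Sieve.singularSeries ({0, (h : ℤ)} : Finset ℤ) * N)
      =o[Filter.atTop] fun N : ℕ => (N : ℝ)) :
    (fun x : ℕ ↦ (primeTupleCount ({0, (h : ℤ)} : Finset ℤ) x : ℝ)) ~[atTop]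
      fun x : ℕ ↦ singularSeries ({0, (h : ℤ)} : Finset ℤ) * x / Real.log x ^ 2 := by
  show (_ - _) =o[atTop] _
  refine isLittleO_iff.mpr fun ε hε ↦ ?_
  -- the auxiliary parameter `δ`
  obtain ⟨δ, hδ0, hδ1, hδε⟩ : ∃ δ : ℝ, 0 < δ ∧ δ ≤ 1 / 2 ∧
      δ * (8 * singularSeries ({0, (h : ℤ)} : Finset ℤ) + 10)
        ≤ ε * singularSeries ({0, (h : ℤ)} : Finset ℤ) := by
    refine ⟨min (1 / 2) (ε * singularSeries ({0, (h : ℤ)} : Finset ℤ)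
      / (8 * singularSeries ({0, (h : ℤ)} : Finset ℤ) + 10)), by positivity, min_le_left _ _, ?_⟩
    calc min (1 / 2) (ε * singularSeries ({0, (h : ℤ)} : Finset ℤ)
          / (8 * singularSeries ({0, (h : ℤ)} : Finset ℤ) + 10))
          * (8 * singularSeries ({0, (h : ℤ)} : Finset ℤ) + 10)
        ≤ ε * singularSeries ({0, (h : ℤ)} : Finset ℤ)
          / (8 * singularSeries ({0, (h : ℤ)} : Finset ℤ) + 10)
          * (8 * singularSeries ({0, (h : ℤ)} : Finset ℤ) + 10) := by
          gcongr
          exact min_le_right _ _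
      _ = ε * singularSeries ({0, (h : ℤ)} : Finset ℤ) := div_mul_cancel₀ _ (by positivity)
  filter_upwards [hP.def hδ0, eventually_log_add_le h hδ0, eventually_rpow_mul_log_sq_le hδ0,
    eventually_properPower_bound_le h hδ0, eventually_ge_atTop 2] with N hTN hcN hdN heN hN2
  have hN0 : (0 : ℝ) < N := by exact_mod_cast (by omega : 0 < N)
  have hLN : 0 < Real.log (N : ℝ) := Real.log_pos (by exact_mod_cast (by omega : 1 < N))
  -- the cut-off `M = ⌊N^{1-δ}⌋`
  set M : ℕ := ⌊(N : ℝ) ^ (1 - δ)⌋₊ with hM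
  have hMle : (M : ℝ) ≤ (N : ℝ) ^ (1 - δ) := Nat.floor_le (by positivity)
  have hMlt : (N : ℝ) ^ (1 - δ) < ((M + 1 : ℕ) : ℝ) := by
    push_cast
    exact Nat.lt_floor_add_one _
  have hLM : (1 - δ) * Real.log N ≤ Real.log ((M + 1 : ℕ) : ℝ) := by
    calc (1 - δ) * Real.log N = Real.log ((N : ℝ) ^ (1 - δ)) := (Real.log_rpow hN0 _).symm
      _ ≤ Real.log ((M + 1 : ℕ) : ℝ) := Real.log_le_log (by positivity) hMlt.le
  have hsplit : ∑ n ∈ Icc 1 N, vonMangoldt n * vonMangoldt (n + h)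
      = ∑ n ∈ (Icc 1 N).filter (fun n ↦ n.Prime ∧ (n + h).Prime),
          vonMangoldt n * vonMangoldt (n + h)
        + ∑ n ∈ (Icc 1 N).filter (fun n ↦ ¬ (n.Prime ∧ (n + h).Prime)),
          vonMangoldt n * vonMangoldt (n + h) :=
    (sum_filter_add_sum_filter_not _ _ _).symm
  rw [Real.norm_eq_abs, Real.norm_of_nonneg hN0.le, hsplit] at hTN
  have hg0 : 0 ≤ singularSeries ({0, (h : ℤ)} : Finset ℤ) * N / Real.log N ^ 2 := by positivity
  simp only [Pi.sub_apply]
  rw [primeTupleCount_pair, Real.norm_eq_abs, Real.norm_eq_abs, abs_of_nonneg hg0]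
  exact abs_count_sub_le_of_bounds hS hN0 hLN hδ0 hδ1 hδε hTN rfl (sum_bothPrime_le h N) hcN
    (sub_mul_log_sq_le_sum_bothPrime h N M) hLM
    (sum_nonneg fun _ _ ↦ mul_nonneg vonMangoldt_nonneg vonMangoldt_nonneg)
    ((sum_not_bothPrime_le h N).trans heN) (Nat.cast_nonneg _) (Nat.cast_nonneg _) hMle hdN

/-- **Characterisation of the item.** `PairsHL` is equivalent to the Hardy–Littlewood prime-pair
conjecture in counting form at every even shift:
`∀ h ≥ 2 even, π_{{0,h}}(x) ∼ 𝔖({0,h}) x / log² x` (the tuples `{0, h}` of the `k = 2` slice of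
`Literature.NumberTheory.Sieve.HardyLittlewoodTuples`, parity.S01, open since 1923; every admissible
pair is a translate of one of these). [folklore] -/
theorem pairsHL_iff_count_even :
    PairsHL ↔ ∀ h : ℕ, Even h → 1 ≤ h →
      (fun x : ℕ ↦ (primeTupleCount ({0, (h : ℤ)} : Finset ℤ) x : ℝ)) ~[atTop]
        fun x : ℕ ↦ singularSeries ({0, (h : ℤ)} : Finset ℤ) * x / Real.log x ^ 2 := by
  constructor
  · intro hP h he hh
    exact count_of_pairsHL_shift (singularSeries_pair_pos_of_even he hh) (hP h hh)
  · intro H h hh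
    rcases Nat.even_or_odd h with he | ho
    · exact pairsHL_shift_of_count (H h he hh)
    · exact pairsHL_odd ho

end Summit.Parity.GeneralizedHardyLittlewood.Theorems.PairsHL

end
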